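import Literature.MathematicalPhysics.QuantumFieldTheory.Balaban1983to89.B5Eq172FlatCoercivity

/-!
# `Balaban1983to89.B9Eq319QprimeLipschitz` — T. Bałaban, *Propagators for lattice gauge theories in a background field*, Commun. Math. Phys.
# **99** (1985) 389–434 [Balaban1985BackgroundPropagators] (3.19) p. 393 with p. 403 and (3.79)–(3.81) p. 406; [Balaban1985Averaging] (2) p. 17,
# (9) p. 18, (139)–(140) p. 39: THE ONE-STEP AVERAGING `Q′(U)` OF GAUGE PARAMETERS IS LIPSCHITZ IN THE BACKGROUND — `‖Q′(U)λ − Q′(1)λ‖_∞ ≤ ρ′·‖λ‖_∞` WITH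
# `ρ′ = (1 + ε)^{d(L−1)} − 1 ≤ d(L−1)·ε·(1 + ε)^{d(L−1)}` EXPLICIT IN THE CLOSENESS `ε` OF THE BOND TRANSPORTERS TO THE IDENTITY

statement-level skeleton of published theorems with citation tags; proofs where landed; nothing here is a claim
about the Yang–Mills mass gap

PDF held: `paper:balaban1985-cmp99-background-propagators` (journal page = PDF page + 388); (3.19) p. 393 through the verbatim quotation of
`B9Eq319QprimeTorus`; p. 403 and (3.79)–(3.81) as quoted by the NE9 owner's `B5Eq172FlatCoercivity` §6 / INTENT [NE9P1-G80-ONLINE].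

THE PRINT.  [B9] (3.19) p. 393: *«(Q′(V)λ)(y) = Σ_{x∈B(y)} L^{−d}R(V(Γ_{y,x}))λ(x)»*; p. 403 (read first-hand by this seat): (3.65) *«Q′(U′U)G′²(U′U)Q′*(U′U)
= Q′(U)G′²(U)Q′*(U) + F′₂(A)G′²(U′U)Q′*(U) + Q′(U)G′²(U′U)F′₂*(A) + …»* — print's perturbation `F′₂(A)` of `Q′` in the background `U′ = e^{iηA}` — and
*«These results imply that the operators R(U), P(U) = I − R(U) extend analytically to the domain (3.37) and satisfy the same bounds»*; p. 406
(3.79): *«|F₂(B)B′| ≤ O(1) sup|B| Q″|B′| … The constant O(1) above depends only on d and L»* (the vector-averaging analogue); [B7] (9) p. 18: *«U(Γ) = Π U(x_i, x_{i+1}), where the order of factors in the product is the same as the order of bonds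
in Γ.»*; [B7] (139) p. 39 (the analogue for the VECTOR averaging, read first-hand by this seat): *«From (124) it is clear that we have the
inequalities |Q_{V₀}A| ≤ Q|A|, |Q″(V₀)A| ≤ C₁L²α₀Q″|A|»* — the averaging in a background close to `1` differs from the flat one by a term small
in the closeness.  The contour `Γ_{y,x}` of [B5] (1.7) has `Σ_κ (x_κ mod L) ≤ d(L − 1)` bonds (`B9Eq319QprimeTorus.length_contour`).

WHY THIS FILE (cell context).  The pub-balaban NE9 owner's planned `B9Thm311SmallFieldCoercivity.exists_coercive_principal_of_small_field` ([B9]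
Thm 3.11's second half AT A FIXED LATTICE, journal [NE9P1-G80-ONLINE]) displays two Lipschitz letters for the averaging operators, `‖Q′(U)λ − Q′(1)λ‖_∞
≤ ρ′‖λ‖` and `‖Q(U)x − Q(1)x‖ ≤ δ_Q‖x‖`; OFFER O-ne9p1-g80-1 names the first, (ρ′), as a leaf target.  This file SUPPLIES (ρ′) for the concrete
(3.19) of `B9Eq319QprimeTorus` with the transporters an ABSTRACT letter `Rb` that is `ε`-close to the identity (`‖Rb(b)v − v‖ ≤ ε‖v‖`, the owner's
transporter-closeness shape), read on the owner's `B9Eq326OperatorAssembly.QprimeW` and on the printed `QprimeAd` (`R(U(b))X = U(b)XU(b)⁻¹`).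

WHAT IS PROVED (sorry-free; axioms `propext`/`Classical.choice`/`Quot.sound`; NO definition, NO `Prop`-valued definition, no new named fact —
[folklore] finite-lattice bookkeeping).
* §1 `norm_pathTr_cons_sub_le` — TELESCOPING: if every step transporter moves vectors by at most `ε‖v‖`, the transport along a path with `n` bonds
  moves them by at most `((1 + ε)^n − 1)‖v‖` (private arithmetic helper `pow_sub_one_le_mul`: `(1 + ε)^n − 1 ≤ n·ε·(1 + ε)^n`);
  `length_contour_le` (`≤ d(L − 1)` bonds).
* §2 `norm_stepTransport_sub_le`; **`norm_QprimeLin_sub_flat_apply_le`** — POINTWISE BLOCK FORM: `‖(Q′(R)λ)(y) − (Q′(1)λ)(y)‖ ≤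
  ρ′(ε)·L^{−d}·Σ_{x∈B(y)} ‖λ(x)‖` with `ρ′(ε) = (1 + ε)^{d(L−1)} − 1`; **`norm_QprimeLin_sub_flat_le`** — SUP FORM: `‖Q′(R)λ − Q′(1)λ‖_∞ ≤ ρ′(ε)·‖λ‖_∞`
  (`|B(y)| = L^d`, `B5Eq172FlatCoercivity.card_blockOf`); `rho_nonneg`, `rho_le` (the linear majorant `d(L−1)·ε·(1 + ε)^{d(L−1)}`);
  `blockMean_norm_sq_le` (Jensen on a block), `sum_blockOf_sum` (the blocks partition the lattice), **`sum_norm_sq_QprimeLin_sub_flat_le`** —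
  HILBERT CURRENCY: `Σ_y ‖(Q′(R)λ − Q′(1)λ)(y)‖² ≤ ρ′(ε)²·L^{−d}·Σ_x ‖λ(x)‖²`.
* §3 **`norm_QprimeW_sub_flat_apply_le`** / **`norm_QprimeW_sub_flat_le`** — the same for the owner's `QprimeW L m φ U` on the `L²` carrier (flat
  companion `QprimeW L m φ 1`, `B5Eq172HodgePositivity.adTransportW_one`), under the transporter-closeness letter
  `∀ b w, ‖adTransportW φ U b w − w‖ ≤ ε‖w‖` — THE (ρ′) LETTER of `exists_coercive_principal_of_small_field`, with `ρ′ := (1 + ε)^{d(L−1)} − 1`;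
  `pi_norm_le_WL2_norm` (`‖λ‖_∞ ≤ c₀^{−1/2}‖λ‖_{L²}`, (3.11)) and **`norm_QprimeW_sub_flat_le_L2`** — the same letter with the `L²` norm on the right;
  **`sum_norm_sq_QprimeW_sub_flat_le`** — `Σ_y ‖(Q′(U)λ − Q′(1)λ)(y)‖² ≤ ρ′²·(L^d c₀)⁻¹·‖λ‖²_{L²}` (Hilbert currency).
* §4 `norm_conj_sub_le` (`‖UXU⁻¹ − X‖ ≤ ε_U(2 + ε_U)‖X‖` from `‖U − 1‖, ‖U⁻¹ − 1‖ ≤ ε_U`), **`norm_QprimeAd_sub_flat_le`** — the printed instance on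
  `𝔸`-valued gauge parameters: `‖Q′(U)λ − Q′(1)λ‖_∞ ≤ ((1 + ε_U(2 + ε_U))^{d(L−1)} − 1)·‖λ‖_∞`; on the chain's `U1`-valued backgrounds ONE
  letter suffices: `norm_conj_sub_le_of_mem_U1` (`2ε_U`), **`norm_QprimeAd_sub_flat_le_of_mem_U1`** (`((1 + 2ε_U)^{d(L−1)} − 1)·‖λ‖_∞`).
MODEL / DECLARED READINGS.  (M1) as `B9Eq319QprimeTorus` (one averaging step on the torus `Π_i ℤ/(L·m_i)ℤ`, blocks B7 (2), contours [B5] (1.7),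
weight `L^{−d}`); sup norms = the product (`Pi`) norms of the function types; the `L²` norm (3.11) enters only in `norm_QprimeW_sub_flat_le_L2`,
through the one-term bound `‖λ(x)‖ ≤ c₀^{−1/2}‖λ‖`, and in `sum_norm_sq_QprimeW_sub_flat_le` through `‖λ‖² = c₀Σ_x‖λ(x)‖²`.  (M2) the transporter closeness `ε` (resp. `ε_U` for both `U(b) − 1` and `U(b)⁻¹ − 1`) is a DISPLAYED letter; its derivation from a
small-field condition on `U` through `φ` is the owner's `(εR)` lemma.  (M3) a FINITE-LATTICE constant: `ρ′` depends on `d`, `L` and `ε` only, but no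
uniformity statement of [B9] (3.85)–(3.86) / [B7] (139), (143) type is claimed.
HONEST SCOPE.  [folklore] telescoping over contours of bounded length; one displayed letter of the owner's small-field coercivity; NOT [B9] Thm 3.11,
NOT (L3) W, NOT summit progress (cell pub-balaban: NE9 NOT PRINTED / NOT PROVED; «NE9 ⇐ the named binders»; spine PROVED 0/9; HONEST DEPENDENCY:
continuum YM on T⁴ ⇐ BetaPertH ∧ nine spine estimates (0/9 proved); BetaPertH ⇐ (D1) ∧ (D4) ∧ CAP+tail; G-an2-4 gates asym, D1 and NE2/3/4).  Unit
`b2b-balaban-t4-ne9-formalise-leaf-03` (NE9 crux-team leaf prover, gen 57), TAKE of OFFER O-ne9p1-g80-1 (ρ′); NEW file importing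
`B5Eq172FlatCoercivity` only (for `card_blockOf`, `QprimeW`, `adTransportW_one`); modifies nothing.
-/

noncomputable section
open scoped BigOperators
namespace Literature.MathematicalPhysics.QuantumFieldTheory.Balaban1983to89.B9Eq319QprimeLipschitz

open B4Sect5Torus (TSite)
open B9SectCLatticeCarrier (Bond shift)
open B9Eq323Ker (avgQ pathTr)
open B9Eq319QprimeTorus (fineP centre contour offset offset_lt length_contour stepTransport weight Qprime QprimeLin QprimeLin_apply QprimeAd)
open B9Eq33CovDerivVector (adTransport adTransport_apply)
open B9Eq310HessianOperator (adTransportW)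
open B9Eq326OperatorAssembly (QprimeW)
open B9Eq311L2Pairing (WL2)
open B11Eq103H1Complex (SiteL2K)
open B5Eq172FlatCoercivity (card_blockOf)
open B5Eq172HodgePositivity (adTransportW_one)

variable {d : ℕ}
/-! ## §1 Telescoping along a path; the contour length -/
section PathTransport

variable {X : Type*} {V : Type*} [NormedAddCommGroup V] [NormedSpace ℝ V]

/-- **TELESCOPING** ([B7] (9): `U(Γ) = Π U(x_i, x_{i+1})`): if every step transporter satisfies `‖τ(x,x′)v − v‖ ≤ ε‖v‖`, then the transport along
the path `x :: p` (with `p.length` bonds) satisfies `‖R(V(Γ))v − v‖ ≤ ((1 + ε)^{|Γ|} − 1)‖v‖`. [cite: Balaban1985Averaging, (9) p.18] -/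
theorem norm_pathTr_cons_sub_le {τ : X → X → V →ₗ[ℝ] V} {ε : ℝ} (hε : 0 ≤ ε) (hτ : ∀ x x' v, ‖τ x x' v - v‖ ≤ ε * ‖v‖) :
    ∀ (p : List X) (x : X) (v : V), ‖pathTr τ (x :: p) v - v‖ ≤ ((1 + ε) ^ p.length - 1) * ‖v‖
  | [], x, v => by simp [B9Eq323Ker.pathTr_singleton]
  | x' :: rest, x, v => by
    have ih := norm_pathTr_cons_sub_le hε hτ rest x' v
    have hpow : 0 ≤ (1 + ε) ^ rest.length - 1 := by
      have : (1 : ℝ) ≤ (1 + ε) ^ rest.length := one_le_pow₀ (by linarith)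
      linarith
    rw [B9Eq323Ker.pathTr_cons_cons, LinearMap.comp_apply, List.length_cons, pow_succ]
    set w := pathTr τ (x' :: rest) v with hw
    calc ‖τ x x' w - v‖ ≤ ‖τ x x' w - w‖ + ‖w - v‖ := norm_sub_le_norm_sub_add_norm_sub _ _ _
      _ ≤ ε * ‖w‖ + ‖w - v‖ := by gcongr; exact hτ x x' w
      _ ≤ ε * (‖v‖ + ‖w - v‖) + ‖w - v‖ := by gcongr; exact norm_le_insert' w v
      _ = (1 + ε) * ‖w - v‖ + ε * ‖v‖ := by ring
      _ ≤ (1 + ε) * (((1 + ε) ^ rest.length - 1) * ‖v‖) + ε * ‖v‖ := by gcongr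
      _ = ((1 + ε) ^ rest.length * (1 + ε) - 1) * ‖v‖ := by ring

/-- The linear majorant: `(1 + ε)^n − 1 ≤ n·ε·(1 + ε)^n` for `ε ≥ 0` (private arithmetic helper). [folklore] -/
private theorem pow_sub_one_le_mul {ε : ℝ} (hε : 0 ≤ ε) : ∀ n : ℕ, (1 + ε) ^ n - 1 ≤ n * ε * (1 + ε) ^ n
  | 0 => by simp
  | n + 1 => by
    have ih := pow_sub_one_le_mul hε n
    have h1 : (1 : ℝ) ≤ (1 + ε) ^ n := one_le_pow₀ (by linarith)
    have h2 : 0 ≤ (n : ℝ) * ε * (1 + ε) ^ n := by positivity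
    rw [pow_succ, Nat.cast_succ]
    have h3 : 0 ≤ ((n : ℝ) + 1) * ε * (1 + ε) ^ n := by positivity
    calc (1 + ε) ^ n * (1 + ε) - 1 = ((1 + ε) ^ n - 1) + ε * (1 + ε) ^ n := by ring
      _ ≤ (n : ℝ) * ε * (1 + ε) ^ n + ε * (1 + ε) ^ n := by gcongr
      _ = ((n : ℝ) + 1) * ε * (1 + ε) ^ n := by ring
      _ ≤ ((n : ℝ) + 1) * ε * (1 + ε) ^ n * (1 + ε) := le_mul_of_one_le_right h3 (by linarith)
      _ = ((n : ℝ) + 1) * ε * ((1 + ε) ^ n * (1 + ε)) := by ring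

end PathTransport
variable (L : ℕ) [NeZero L] (m : Fin d → ℕ)

/-- **THE CONTOURS HAVE AT MOST `d(L − 1)` BONDS**: `|Γ_{y,x}| = Σ_κ (x_κ mod L) ≤ d(L − 1)`. [cite: Balaban1984PropagatorsI, (1.7) p.18; Balaban1985Averaging, (2) p.17] -/
theorem length_contour_le (x : TSite d (fineP L m)) : (contour L m x).length ≤ d * (L - 1) := by
  rw [length_contour]
  calc ∑ κ, offset L m x κ ≤ ∑ _κ : Fin d, (L - 1) := Finset.sum_le_sum fun κ _ => Nat.le_sub_one_of_lt (offset_lt L m x κ)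
    _ = d * (L - 1) := by simp

/-! ## §2 (ρ′) for the concrete (3.19): `‖Q′(R)λ − Q′(1)λ‖_∞ ≤ ((1 + ε)^{d(L−1)} − 1)·‖λ‖_∞` -/
section QprimeLip
variable {V : Type*} [NormedAddCommGroup V] [NormedSpace ℂ V]

omit [NeZero L] in
/-- The step transporter of `B9Eq319QprimeTorus` inherits the closeness of the bond transporters (it is a bond transporter or the identity).
[cite: Balaban1985BackgroundPropagators, (3.19) p.393] -/
theorem norm_stepTransport_sub_le (Rb : Bond d (fineP L m) → V →ₗ[ℂ] V) {ε : ℝ} (hε : 0 ≤ ε) (hR : ∀ b v, ‖Rb b v - v‖ ≤ ε * ‖v‖)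
    (x x' : TSite d (fineP L m)) (v : V) : ‖stepTransport L m (fun b => (Rb b).restrictScalars ℝ) x x' v - v‖ ≤ ε * ‖v‖ := by
  unfold stepTransport
  split_ifs with h
  · exact hR _ v
  · rw [LinearMap.id_apply, sub_self, norm_zero]; positivity

/-- The flat companion: with identity transporters `Q′` is the plain block mean (as `B9Eq319QprimeTorus.Qprime_flat`, for the `ℂ`-linear reading).
[cite: Balaban1985Averaging, p.27; Balaban1985BackgroundPropagators, (3.19) p.393] -/
theorem QprimeLin_flat_apply (l : TSite d (fineP L m) → V) (y : TSite d m) :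
    QprimeLin L m (fun _ : Bond d (fineP L m) => (LinearMap.id : V →ₗ[ℂ] V)) l y = ∑ x ∈ B9Eq319QprimeTorus.blockOf L m y, ((L : ℝ) ^ d)⁻¹ • l x := by
  have h : (fun _ : Bond d (fineP L m) => ((LinearMap.id : V →ₗ[ℂ] V)).restrictScalars ℝ) =
      fun _ : Bond d (fineP L m) => (LinearMap.id : V →ₗ[ℝ] V) := rfl
  rw [QprimeLin_apply, h, B9Eq319QprimeTorus.Qprime_flat]

omit [NeZero L] in
/-- The modulus `ρ′(ε) = (1 + ε)^{d(L−1)} − 1` of the bound is `≥ 0` (p. 403: the operators at `U` «satisfy the same bounds»; here the explicit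
finite-lattice modulus). [cite: Balaban1985BackgroundPropagators, p.403] -/
theorem rho_nonneg {ε : ℝ} (hε : 0 ≤ ε) : 0 ≤ (1 + ε) ^ (d * (L - 1)) - 1 := by
  have : (1 : ℝ) ≤ (1 + ε) ^ (d * (L - 1)) := one_le_pow₀ (by linarith)
  linarith

omit [NeZero L] in
/-- `ρ′(ε) ≤ d(L−1)·ε·(1 + ε)^{d(L−1)}` — the modulus is `O(d·L)·ε` for small `ε` (linear in the closeness of the transporters, as the
perturbative bounds (3.79)–(3.81) of `F′₂`; [B7] (139) `C₁L²α₀` for the vector averaging). [cite: Balaban1985BackgroundPropagators, p.403, (3.79)–(3.81) p.406; Balaban1985Averaging, (139) p.39] -/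
theorem rho_le {ε : ℝ} (hε : 0 ≤ ε) : (1 + ε) ^ (d * (L - 1)) - 1 ≤ (d * (L - 1) : ℕ) * ε * (1 + ε) ^ (d * (L - 1)) :=
  pow_sub_one_le_mul hε _

/-- **(ρ′), POINTWISE BLOCK FORM**: for `ℂ`-linear bond transporters `ε`-close to the identity (`‖R(b)v − v‖ ≤ ε‖v‖`),
`‖(Q′(R)λ)(y) − (Q′(1)λ)(y)‖ ≤ ((1 + ε)^{d(L−1)} − 1)·L^{−d}·Σ_{x∈B(y)} ‖λ(x)‖` — each term of (3.19) is transported along a contour of at most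
`d(L−1)` bonds (§1). [cite: Balaban1985BackgroundPropagators, (3.19) p.393, p.403] -/
theorem norm_QprimeLin_sub_flat_apply_le (Rb : Bond d (fineP L m) → V →ₗ[ℂ] V) {ε : ℝ} (hε : 0 ≤ ε)
    (hR : ∀ b v, ‖Rb b v - v‖ ≤ ε * ‖v‖) (l : TSite d (fineP L m) → V) (y : TSite d m) :
    ‖QprimeLin L m Rb l y - QprimeLin L m (fun _ => LinearMap.id) l y‖ ≤
      ((1 + ε) ^ (d * (L - 1)) - 1) * (((L : ℝ) ^ d)⁻¹ * ∑ x ∈ B9Eq319QprimeTorus.blockOf L m y, ‖l x‖) := by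
  have hρ := rho_nonneg L (d := d) hε
  have hw : 0 ≤ ((L : ℝ) ^ d)⁻¹ := by positivity
  rw [QprimeLin_flat_apply, QprimeLin_apply, Qprime, avgQ, ← Finset.sum_sub_distrib, Finset.mul_sum, Finset.mul_sum]
  refine (norm_sum_le _ _).trans (Finset.sum_le_sum fun x _ => ?_)
  rw [weight, ← smul_sub, norm_smul, norm_inv, norm_pow, Real.norm_natCast]
  -- the transported term: a path with `(contour x).length ≤ d(L−1)` bonds
  have hstep := norm_stepTransport_sub_le L m Rb hε hR
  have h1 := norm_pathTr_cons_sub_le hε hstep (contour L m x) (centre L m y) (l x)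
  have h2 : (1 + ε) ^ (contour L m x).length - 1 ≤ (1 + ε) ^ (d * (L - 1)) - 1 :=
    sub_le_sub_right (pow_le_pow_right₀ (by linarith) (length_contour_le L m x)) 1
  calc ((L : ℝ) ^ d)⁻¹ * ‖pathTr (stepTransport L m fun b => (Rb b).restrictScalars ℝ) (centre L m y :: contour L m x) (l x) - l x‖
      ≤ ((L : ℝ) ^ d)⁻¹ * (((1 + ε) ^ (d * (L - 1)) - 1) * ‖l x‖) := by
        refine mul_le_mul_of_nonneg_left (h1.trans ?_) hw
        exact mul_le_mul_of_nonneg_right h2 (norm_nonneg _)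
    _ = ((1 + ε) ^ (d * (L - 1)) - 1) * (((L : ℝ) ^ d)⁻¹ * ‖l x‖) := by ring

omit [NormedSpace ℂ V] in
/-- The block mean of the norms is bounded by the sup norm: `L^{−d}·Σ_{x∈B(y)} ‖λ(x)‖ ≤ ‖λ‖_∞` (`|B(y)| = L^d`).
[cite: Balaban1985Averaging, (2) p.17] -/
theorem blockMean_norm_le (l : TSite d (fineP L m) → V) (y : TSite d m) :
    ((L : ℝ) ^ d)⁻¹ * ∑ x ∈ B9Eq319QprimeTorus.blockOf L m y, ‖l x‖ ≤ ‖l‖ := by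
  have hL : (0 : ℝ) < (L : ℝ) ^ d := by
    have : (0 : ℝ) < L := by exact_mod_cast Nat.pos_of_ne_zero (NeZero.ne L)
    positivity
  have hsum : ∑ x ∈ B9Eq319QprimeTorus.blockOf L m y, ‖l x‖ ≤ (L : ℝ) ^ d * ‖l‖ := by
    calc ∑ x ∈ B9Eq319QprimeTorus.blockOf L m y, ‖l x‖ ≤ ∑ _x ∈ B9Eq319QprimeTorus.blockOf L m y, ‖l‖ := Finset.sum_le_sum fun x _ => norm_le_pi_norm l x
      _ = (L : ℝ) ^ d * ‖l‖ := by rw [Finset.sum_const, card_blockOf, nsmul_eq_mul, Nat.cast_pow]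
  rw [inv_mul_le_iff₀ hL]
  exact hsum

/-- **(ρ′), SUP FORM — `Q′` IS LIPSCHITZ IN THE BACKGROUND**: `‖Q′(R)λ − Q′(1)λ‖_∞ ≤ ((1 + ε)^{d(L−1)} − 1)·‖λ‖_∞` for bond transporters
`ε`-close to the identity (p. 403: the averaging and projection operators at `U` «satisfy the same bounds» as at `U = 1`; here the explicit
finite-lattice modulus of continuity in `U`). [cite: Balaban1985BackgroundPropagators, (3.19) p.393, p.403, (3.79)–(3.81) p.406] -/
theorem norm_QprimeLin_sub_flat_le (Rb : Bond d (fineP L m) → V →ₗ[ℂ] V) {ε : ℝ} (hε : 0 ≤ ε)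
    (hR : ∀ b v, ‖Rb b v - v‖ ≤ ε * ‖v‖) (l : TSite d (fineP L m) → V) :
    ‖QprimeLin L m Rb l - QprimeLin L m (fun _ => LinearMap.id) l‖ ≤ ((1 + ε) ^ (d * (L - 1)) - 1) * ‖l‖ := by
  have hρ := rho_nonneg L (d := d) hε
  refine (pi_norm_le_iff_of_nonneg (by positivity)).2 fun y => ?_
  rw [Pi.sub_apply]
  exact (norm_QprimeLin_sub_flat_apply_le L m Rb hε hR l y).trans (mul_le_mul_of_nonneg_left (blockMean_norm_le L m l y) hρ)

omit [NormedSpace ℂ V] in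
/-- Jensen on a block: `(L^{−d}·Σ_{x∈B(y)} ‖λ(x)‖)² ≤ L^{−d}·Σ_{x∈B(y)} ‖λ(x)‖²` (Cauchy–Schwarz with `|B(y)| = L^d`).
[cite: Balaban1985Averaging, (2) p.17] -/
theorem blockMean_norm_sq_le (l : TSite d (fineP L m) → V) (y : TSite d m) :
    (((L : ℝ) ^ d)⁻¹ * ∑ x ∈ B9Eq319QprimeTorus.blockOf L m y, ‖l x‖) ^ 2 ≤
      ((L : ℝ) ^ d)⁻¹ * ∑ x ∈ B9Eq319QprimeTorus.blockOf L m y, ‖l x‖ ^ 2 := by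
  have hL : (0 : ℝ) < (L : ℝ) ^ d := by
    have : (0 : ℝ) < L := by exact_mod_cast Nat.pos_of_ne_zero (NeZero.ne L)
    positivity
  have h := sq_sum_le_card_mul_sum_sq (s := B9Eq319QprimeTorus.blockOf L m y) (f := fun x => ‖l x‖)
  rw [card_blockOf, Nat.cast_pow] at h
  rw [mul_pow]
  calc (((L : ℝ) ^ d)⁻¹) ^ 2 * (∑ x ∈ B9Eq319QprimeTorus.blockOf L m y, ‖l x‖) ^ 2
      ≤ (((L : ℝ) ^ d)⁻¹) ^ 2 * ((L : ℝ) ^ d * ∑ x ∈ B9Eq319QprimeTorus.blockOf L m y, ‖l x‖ ^ 2) :=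
        mul_le_mul_of_nonneg_left h (by positivity)
    _ = ((L : ℝ) ^ d)⁻¹ * ∑ x ∈ B9Eq319QprimeTorus.blockOf L m y, ‖l x‖ ^ 2 := by
        field_simp

omit [NeZero L] in
/-- The blocks partition the fine lattice (B7 (4)): `Σ_y Σ_{x∈B(y)} g(x) = Σ_x g(x)`. [cite: Balaban1985Averaging, (4) p.18] -/
theorem sum_blockOf_sum {M : Type*} [AddCommMonoid M] (g : TSite d (fineP L m) → M) :
    ∑ y, ∑ x ∈ B9Eq319QprimeTorus.blockOf L m y, g x = ∑ x, g x := by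
  simp only [B9Eq319QprimeTorus.blockOf]
  exact Finset.sum_fiberwise Finset.univ (B9Eq319QprimeTorus.blockCoord L m) g

/-- **(ρ′), HILBERT CURRENCY — `Σ_y ‖(Q′(R)λ − Q′(1)λ)(y)‖² ≤ ρ′(ε)²·L^{−d}·Σ_x ‖λ(x)‖²`** (block form + Jensen + the block partition):
the unweighted `ℓ²` norms of the coarse difference against the fine parameter. [cite: Balaban1985BackgroundPropagators, (3.19) p.393, (3.11) p.392, p.403] -/
theorem sum_norm_sq_QprimeLin_sub_flat_le (Rb : Bond d (fineP L m) → V →ₗ[ℂ] V) {ε : ℝ} (hε : 0 ≤ ε)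
    (hR : ∀ b v, ‖Rb b v - v‖ ≤ ε * ‖v‖) (l : TSite d (fineP L m) → V) :
    ∑ y, ‖QprimeLin L m Rb l y - QprimeLin L m (fun _ => LinearMap.id) l y‖ ^ 2 ≤
      ((1 + ε) ^ (d * (L - 1)) - 1) ^ 2 * (((L : ℝ) ^ d)⁻¹ * ∑ x, ‖l x‖ ^ 2) := by
  have hρ := rho_nonneg L (d := d) hε
  calc ∑ y, ‖QprimeLin L m Rb l y - QprimeLin L m (fun _ => LinearMap.id) l y‖ ^ 2
      ≤ ∑ y, (((1 + ε) ^ (d * (L - 1)) - 1) * (((L : ℝ) ^ d)⁻¹ * ∑ x ∈ B9Eq319QprimeTorus.blockOf L m y, ‖l x‖)) ^ 2 :=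
        Finset.sum_le_sum fun y _ => pow_le_pow_left₀ (norm_nonneg _) (norm_QprimeLin_sub_flat_apply_le L m Rb hε hR l y) 2
    _ ≤ ∑ y, ((1 + ε) ^ (d * (L - 1)) - 1) ^ 2 * (((L : ℝ) ^ d)⁻¹ * ∑ x ∈ B9Eq319QprimeTorus.blockOf L m y, ‖l x‖ ^ 2) :=
        Finset.sum_le_sum fun y _ => by
          rw [mul_pow]; exact mul_le_mul_of_nonneg_left (blockMean_norm_sq_le L m l y) (sq_nonneg _)
    _ = ((1 + ε) ^ (d * (L - 1)) - 1) ^ 2 * (((L : ℝ) ^ d)⁻¹ * ∑ x, ‖l x‖ ^ 2) := by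
        rw [← Finset.mul_sum, ← Finset.mul_sum, sum_blockOf_sum]

end QprimeLip

/-! ## §3 (ρ′) on the owner's `QprimeW` (the `L²` carrier of the NE9 chain) -/
section QprimeWLip
variable {𝔸 : Type*} [Ring 𝔸] [Algebra ℂ 𝔸] {W : Type*} [NormedAddCommGroup W] [InnerProductSpace ℂ W] (φ : W ≃ₗ[ℂ] 𝔸) {c₀ : ℝ}
  (U : Bond d (fineP L m) → 𝔸ˣ)

/-- The flat `Q′(1)` on the `L²` carrier is the plain block mean of the underlying function. [cite: Balaban1985BackgroundPropagators, (3.19) p.393, p.395] -/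
theorem QprimeW_one_apply (lam : SiteL2K ℂ d (fineP L m) c₀ W) (y : TSite d m) :
    QprimeW L m φ (fun _ : Bond d (fineP L m) => (1 : 𝔸ˣ)) (c₀ := c₀) lam y =
      ∑ x ∈ B9Eq319QprimeTorus.blockOf L m y, ((L : ℝ) ^ d)⁻¹ • (WL2.linearEquiv ℂ ℂ (fun _ : TSite d (fineP L m) => c₀) lam) x := by
  have h1 : adTransportW φ (fun _ : Bond d (fineP L m) => (1 : 𝔸ˣ)) = fun _ => LinearMap.id := funext (adTransportW_one φ)
  rw [QprimeW, LinearMap.comp_apply, h1]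
  exact QprimeLin_flat_apply L m _ y

/-- **(ρ′) ON THE `L²` CARRIER, POINTWISE BLOCK FORM**: under the transporter-closeness letter `‖R(U(b))w − w‖ ≤ ε‖w‖` (read on the Hilbert fibre),
`‖(Q′(U)λ)(y) − (Q′(1)λ)(y)‖ ≤ ((1 + ε)^{d(L−1)} − 1)·L^{−d}·Σ_{x∈B(y)} ‖λ(x)‖`. [cite: Balaban1985BackgroundPropagators, (3.19) p.393, p.403] -/
theorem norm_QprimeW_sub_flat_apply_le {ε : ℝ} (hε : 0 ≤ ε) (hR : ∀ b w, ‖adTransportW φ U b w - w‖ ≤ ε * ‖w‖)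
    (lam : SiteL2K ℂ d (fineP L m) c₀ W) (y : TSite d m) :
    ‖QprimeW L m φ U (c₀ := c₀) lam y - QprimeW L m φ (fun _ => 1) (c₀ := c₀) lam y‖ ≤
      ((1 + ε) ^ (d * (L - 1)) - 1) *
        (((L : ℝ) ^ d)⁻¹ * ∑ x ∈ B9Eq319QprimeTorus.blockOf L m y, ‖(WL2.linearEquiv ℂ ℂ (fun _ : TSite d (fineP L m) => c₀) lam) x‖) := by
  have h1 : adTransportW φ (fun _ : Bond d (fineP L m) => (1 : 𝔸ˣ)) = fun _ => LinearMap.id := funext (adTransportW_one φ)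
  rw [QprimeW, QprimeW, LinearMap.comp_apply, LinearMap.comp_apply, h1]
  exact norm_QprimeLin_sub_flat_apply_le L m (adTransportW φ U) hε hR _ y

/-- **(ρ′) ON THE `L²` CARRIER, SUP FORM — THE LETTER OF `exists_coercive_principal_of_small_field`**: `‖Q′(U)λ − Q′(1)λ‖_∞ ≤ ρ′·‖λ‖_∞` with
`ρ′ = (1 + ε)^{d(L−1)} − 1`, `‖λ‖_∞` the sup norm of the underlying `W`-valued function. [cite: Balaban1985BackgroundPropagators, (3.19) p.393, p.403, (3.79)–(3.81) p.406] -/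
theorem norm_QprimeW_sub_flat_le {ε : ℝ} (hε : 0 ≤ ε) (hR : ∀ b w, ‖adTransportW φ U b w - w‖ ≤ ε * ‖w‖)
    (lam : SiteL2K ℂ d (fineP L m) c₀ W) :
    ‖QprimeW L m φ U (c₀ := c₀) lam - QprimeW L m φ (fun _ => 1) (c₀ := c₀) lam‖ ≤
      ((1 + ε) ^ (d * (L - 1)) - 1) * ‖WL2.linearEquiv ℂ ℂ (fun _ : TSite d (fineP L m) => c₀) lam‖ := by
  have h1 : adTransportW φ (fun _ : Bond d (fineP L m) => (1 : 𝔸ˣ)) = fun _ => LinearMap.id := funext (adTransportW_one φ)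
  rw [QprimeW, QprimeW, LinearMap.comp_apply, LinearMap.comp_apply, h1]
  exact norm_QprimeLin_sub_flat_le L m (adTransportW φ U) hε hR _

variable [Fact (0 < c₀)]
omit [NeZero L] in
/-- The sup norm of a gauge parameter is controlled by its weighted `L²` norm (3.11): `‖λ(x)‖ ≤ c₀^{−1/2}·‖λ‖` (one term of the sum
`‖λ‖² = Σ_x c₀‖λ(x)‖²`). [cite: Balaban1985BackgroundPropagators, (3.11) p.392] -/
theorem pi_norm_le_WL2_norm (lam : SiteL2K ℂ d (fineP L m) c₀ W) :
    ‖WL2.linearEquiv ℂ ℂ (fun _ : TSite d (fineP L m) => c₀) lam‖ ≤ (Real.sqrt c₀)⁻¹ * ‖lam‖ := by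
  have hc : 0 < c₀ := Fact.out
  have hs : 0 < Real.sqrt c₀ := Real.sqrt_pos.2 hc
  refine (pi_norm_le_iff_of_nonneg (by positivity)).2 fun x => ?_
  rw [WL2.linearEquiv_apply, le_inv_mul_iff₀ hs]
  have h := WL2.weight_mul_norm_sq_apply_le (𝕜 := ℂ) (w := fun _ : TSite d (fineP L m) => c₀) lam x
  have h' : (Real.sqrt c₀ * ‖WL2.equiv ℂ (fun _ : TSite d (fineP L m) => c₀) W lam x‖) ^ 2 ≤ ‖lam‖ ^ 2 := by
    rw [mul_pow, Real.sq_sqrt hc.le]; exact h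
  exact (pow_le_pow_iff_left₀ (by positivity) (norm_nonneg _) two_ne_zero).1 h'

/-- **(ρ′) WITH THE `L²` NORM (3.11) ON THE RIGHT**: `‖Q′(U)λ − Q′(1)λ‖_∞ ≤ ρ′·c₀^{−1/2}·‖λ‖_{L²}` — the same letter in the chain's `L²` currency.
[cite: Balaban1985BackgroundPropagators, (3.19) p.393, (3.11) p.392, p.403] -/
theorem norm_QprimeW_sub_flat_le_L2 {ε : ℝ} (hε : 0 ≤ ε) (hR : ∀ b w, ‖adTransportW φ U b w - w‖ ≤ ε * ‖w‖)
    (lam : SiteL2K ℂ d (fineP L m) c₀ W) :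
    ‖QprimeW L m φ U (c₀ := c₀) lam - QprimeW L m φ (fun _ => 1) (c₀ := c₀) lam‖ ≤
      ((1 + ε) ^ (d * (L - 1)) - 1) * ((Real.sqrt c₀)⁻¹ * ‖lam‖) :=
  (norm_QprimeW_sub_flat_le L m φ U hε hR lam).trans
    (mul_le_mul_of_nonneg_left (pi_norm_le_WL2_norm L m lam) (rho_nonneg L (d := d) hε))

/-- **(ρ′) ON THE `L²` CARRIER, HILBERT CURRENCY**: `Σ_y ‖(Q′(U)λ − Q′(1)λ)(y)‖² ≤ ρ′²·(L^d·c₀)⁻¹·‖λ‖²_{L²}` — the coarse `ℓ²` norm of the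
difference against the weighted `L²` norm (3.11) of the parameter (`‖λ‖² = c₀·Σ_x ‖λ(x)‖²`). [cite: Balaban1985BackgroundPropagators, (3.19) p.393, (3.11) p.392, p.403] -/
theorem sum_norm_sq_QprimeW_sub_flat_le {ε : ℝ} (hε : 0 ≤ ε) (hR : ∀ b w, ‖adTransportW φ U b w - w‖ ≤ ε * ‖w‖)
    (lam : SiteL2K ℂ d (fineP L m) c₀ W) :
    ∑ y, ‖QprimeW L m φ U (c₀ := c₀) lam y - QprimeW L m φ (fun _ => 1) (c₀ := c₀) lam y‖ ^ 2 ≤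
      ((1 + ε) ^ (d * (L - 1)) - 1) ^ 2 * (((L : ℝ) ^ d * c₀)⁻¹ * ‖lam‖ ^ 2) := by
  have hc : 0 < c₀ := Fact.out
  have h1 : adTransportW φ (fun _ : Bond d (fineP L m) => (1 : 𝔸ˣ)) = fun _ => LinearMap.id := funext (adTransportW_one φ)
  have hn : ‖lam‖ ^ 2 = c₀ * ∑ x, ‖WL2.linearEquiv ℂ ℂ (fun _ : TSite d (fineP L m) => c₀) lam x‖ ^ 2 := by
    rw [WL2.norm_sq, Finset.mul_sum]; rfl
  have hsum : ((L : ℝ) ^ d * c₀)⁻¹ * ‖lam‖ ^ 2 = ((L : ℝ) ^ d)⁻¹ * ∑ x, ‖WL2.linearEquiv ℂ ℂ (fun _ : TSite d (fineP L m) => c₀) lam x‖ ^ 2 := by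
    rw [hn, mul_inv, mul_assoc, inv_mul_cancel_left₀ hc.ne']
  rw [hsum, QprimeW, QprimeW, h1]
  exact sum_norm_sq_QprimeLin_sub_flat_le L m (adTransportW φ U) hε hR _

end QprimeWLip

/-! ## §4 The printed instance `R(U(b))X = U(b)XU(b)⁻¹` on `𝔸`-valued gauge parameters -/
section Printed
variable {𝔸 : Type*} [NormedRing 𝔸] [NormedAlgebra ℂ 𝔸] [NormOneClass 𝔸]

omit [NormedAlgebra ℂ 𝔸] in
/-- Conjugation by a unit close to `1` moves little: `‖U − 1‖ ≤ ε_U`, `‖U⁻¹ − 1‖ ≤ ε_U` ⇒ `‖UXU⁻¹ − X‖ ≤ ε_U(2 + ε_U)‖X‖`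
(`UXU⁻¹ − X = (U − 1)XU⁻¹ + X(U⁻¹ − 1)`), for the printed transporter `R(U)X = UXU⁻¹` of p. 390. [cite: Balaban1985BackgroundPropagators, p.390] -/
theorem norm_conj_sub_le (U : 𝔸ˣ) {εU : ℝ} (hU : ‖(U : 𝔸) - 1‖ ≤ εU) (hU' : ‖((U⁻¹ : 𝔸ˣ) : 𝔸) - 1‖ ≤ εU) (X : 𝔸) :
    ‖(U : 𝔸) * X * ((U⁻¹ : 𝔸ˣ) : 𝔸) - X‖ ≤ εU * (2 + εU) * ‖X‖ := by
  have hε : 0 ≤ εU := (norm_nonneg _).trans hU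
  have hinv : ‖((U⁻¹ : 𝔸ˣ) : 𝔸)‖ ≤ 1 + εU := by
    calc ‖((U⁻¹ : 𝔸ˣ) : 𝔸)‖ ≤ ‖(1 : 𝔸)‖ + ‖((U⁻¹ : 𝔸ˣ) : 𝔸) - 1‖ := norm_le_insert' _ _
      _ ≤ 1 + εU := by rw [norm_one]; linarith
  have hsplit : (U : 𝔸) * X * ((U⁻¹ : 𝔸ˣ) : 𝔸) - X = ((U : 𝔸) - 1) * X * ((U⁻¹ : 𝔸ˣ) : 𝔸) + X * (((U⁻¹ : 𝔸ˣ) : 𝔸) - 1) := by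
    noncomm_ring
  rw [hsplit]
  calc ‖((U : 𝔸) - 1) * X * ((U⁻¹ : 𝔸ˣ) : 𝔸) + X * (((U⁻¹ : 𝔸ˣ) : 𝔸) - 1)‖
      ≤ ‖((U : 𝔸) - 1) * X * ((U⁻¹ : 𝔸ˣ) : 𝔸)‖ + ‖X * (((U⁻¹ : 𝔸ˣ) : 𝔸) - 1)‖ := norm_add_le _ _
    _ ≤ ‖(U : 𝔸) - 1‖ * ‖X‖ * ‖((U⁻¹ : 𝔸ˣ) : 𝔸)‖ + ‖X‖ * ‖((U⁻¹ : 𝔸ˣ) : 𝔸) - 1‖ :=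
        add_le_add ((norm_mul_le _ _).trans (mul_le_mul_of_nonneg_right (norm_mul_le _ _) (norm_nonneg _))) (norm_mul_le _ _)
    _ ≤ εU * ‖X‖ * (1 + εU) + ‖X‖ * εU := by gcongr
    _ = εU * (2 + εU) * ‖X‖ := by ring

omit [NeZero L] in
/-- The printed transporter is `ε_U(2 + ε_U)`-close to the identity. [cite: Balaban1985BackgroundPropagators, p.390] -/
theorem norm_adTransport_sub_le (U : Bond d (fineP L m) → 𝔸ˣ) {εU : ℝ} (hU : ∀ b, ‖(U b : 𝔸) - 1‖ ≤ εU)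
    (hU' : ∀ b, ‖((U b)⁻¹ : 𝔸ˣ) - (1 : 𝔸)‖ ≤ εU) (b : Bond d (fineP L m)) (X : 𝔸) :
    ‖adTransport (𝕜 := ℂ) U b X - X‖ ≤ εU * (2 + εU) * ‖X‖ := by
  rw [adTransport_apply]
  exact norm_conj_sub_le (U b) (hU b) (hU' b) X

/-- **(ρ′) FOR THE PRINTED `Q′(U)`** (`R(U(b))X = U(b)XU(b)⁻¹` on `𝔸 ⊇ 𝔤ᶜ`): `‖Q′(U)λ − Q′(1)λ‖_∞ ≤ ((1 + ε_U(2 + ε_U))^{d(L−1)} − 1)·‖λ‖_∞`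
whenever `‖U(b) − 1‖, ‖U(b)⁻¹ − 1‖ ≤ ε_U` for all bonds. [cite: Balaban1985BackgroundPropagators, (3.19) p.393, p.403] -/
theorem norm_QprimeAd_sub_flat_le (U : Bond d (fineP L m) → 𝔸ˣ) {εU : ℝ} (hεU : 0 ≤ εU) (hU : ∀ b, ‖(U b : 𝔸) - 1‖ ≤ εU)
    (hU' : ∀ b, ‖((U b)⁻¹ : 𝔸ˣ) - (1 : 𝔸)‖ ≤ εU) (l : TSite d (fineP L m) → 𝔸) :
    ‖QprimeAd L m U l - QprimeAd L m (fun _ => 1) l‖ ≤ ((1 + εU * (2 + εU)) ^ (d * (L - 1)) - 1) * ‖l‖ := by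
  have h1 : adTransport (𝕜 := ℂ) (fun _ : Bond d (fineP L m) => (1 : 𝔸ˣ)) = fun _ => LinearMap.id :=
    funext (B9Eq33CovDerivVector.adTransport_one (𝕜 := ℂ))
  rw [QprimeAd, QprimeAd, h1]
  exact norm_QprimeLin_sub_flat_le L m (adTransport (𝕜 := ℂ) U) (by positivity) (norm_adTransport_sub_le L m U hU hU') l

omit [NormedAlgebra ℂ 𝔸] in
/-- On the unit-ball group `U1 𝔸` (`‖U‖, ‖U⁻¹‖ ≤ 1`, the chain's background letter) ONE closeness letter suffices and the constant improves:
`‖U − 1‖ ≤ ε_U ⇒ ‖UXU⁻¹ − X‖ ≤ 2ε_U‖X‖` (`‖U⁻¹ − 1‖ ≤ ‖U − 1‖` on `U1`, `B7Prop1Explicit.norm_inv_sub_one_le`). [cite: Balaban1985BackgroundPropagators, p.390; Balaban1985Averaging, (9) p.18] -/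
theorem norm_conj_sub_le_of_mem_U1 {U : 𝔸ˣ} (hU1 : U ∈ B7Prop1Explicit.U1 𝔸) {εU : ℝ} (hU : ‖(U : 𝔸) - 1‖ ≤ εU) (X : 𝔸) :
    ‖(U : 𝔸) * X * ((U⁻¹ : 𝔸ˣ) : 𝔸) - X‖ ≤ 2 * εU * ‖X‖ := by
  have hinv1 : ‖((U⁻¹ : 𝔸ˣ) : 𝔸)‖ ≤ 1 := (B7Prop1Explicit.mem_U1.1 hU1).2
  have hinv : ‖((U⁻¹ : 𝔸ˣ) : 𝔸) - 1‖ ≤ εU := (B7Prop1Explicit.norm_inv_sub_one_le hU1).trans hU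
  have hε : 0 ≤ εU := (norm_nonneg _).trans hU
  have hsplit : (U : 𝔸) * X * ((U⁻¹ : 𝔸ˣ) : 𝔸) - X = ((U : 𝔸) - 1) * X * ((U⁻¹ : 𝔸ˣ) : 𝔸) + X * (((U⁻¹ : 𝔸ˣ) : 𝔸) - 1) := by
    noncomm_ring
  rw [hsplit]
  calc ‖((U : 𝔸) - 1) * X * ((U⁻¹ : 𝔸ˣ) : 𝔸) + X * (((U⁻¹ : 𝔸ˣ) : 𝔸) - 1)‖
      ≤ ‖((U : 𝔸) - 1) * X * ((U⁻¹ : 𝔸ˣ) : 𝔸)‖ + ‖X * (((U⁻¹ : 𝔸ˣ) : 𝔸) - 1)‖ := norm_add_le _ _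
    _ ≤ ‖(U : 𝔸) - 1‖ * ‖X‖ * ‖((U⁻¹ : 𝔸ˣ) : 𝔸)‖ + ‖X‖ * ‖((U⁻¹ : 𝔸ˣ) : 𝔸) - 1‖ :=
        add_le_add ((norm_mul_le _ _).trans (mul_le_mul_of_nonneg_right (norm_mul_le _ _) (norm_nonneg _))) (norm_mul_le _ _)
    _ ≤ εU * ‖X‖ * 1 + ‖X‖ * εU := by gcongr
    _ = 2 * εU * ‖X‖ := by ring

/-- **(ρ′) FOR THE PRINTED `Q′(U)` AT A `U1`-VALUED BACKGROUND** (the chain's `hU1` letter): `‖U(b) − 1‖ ≤ ε_U` for all bonds ⇒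
`‖Q′(U)λ − Q′(1)λ‖_∞ ≤ ((1 + 2ε_U)^{d(L−1)} − 1)·‖λ‖_∞`. [cite: Balaban1985BackgroundPropagators, (3.19) p.393, p.403] -/
theorem norm_QprimeAd_sub_flat_le_of_mem_U1 (U : Bond d (fineP L m) → 𝔸ˣ) (hU1 : ∀ b, U b ∈ B7Prop1Explicit.U1 𝔸) {εU : ℝ}
    (hεU : 0 ≤ εU) (hU : ∀ b, ‖(U b : 𝔸) - 1‖ ≤ εU) (l : TSite d (fineP L m) → 𝔸) :
    ‖QprimeAd L m U l - QprimeAd L m (fun _ => 1) l‖ ≤ ((1 + 2 * εU) ^ (d * (L - 1)) - 1) * ‖l‖ := by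
  have h1 : adTransport (𝕜 := ℂ) (fun _ : Bond d (fineP L m) => (1 : 𝔸ˣ)) = fun _ => LinearMap.id :=
    funext (B9Eq33CovDerivVector.adTransport_one (𝕜 := ℂ))
  rw [QprimeAd, QprimeAd, h1]
  refine norm_QprimeLin_sub_flat_le L m (adTransport (𝕜 := ℂ) U) (by positivity) (fun b X => ?_) l
  rw [adTransport_apply]
  exact norm_conj_sub_le_of_mem_U1 (hU1 b) (hU b) X

end Printed
end Literature.MathematicalPhysics.QuantumFieldTheory.Balaban1983to89.B9Eq319QprimeLipschitz
end
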